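import Summits.BirchSwinnertonDyer.BirchSwinnertonDyer.Theses.ErratumRoadFive

/-!
# BC3 birth skeleton — crux `ErratumRoadFive.ShimuraKolyvaginOrderBoundInertFromFive` (item stmt-BirchSwinnertonDyer-19718; the INERT Shimura–Kolyvagin slice, p ∣ N⁻, 5 ≤ p, ρ̄ onto)

Route `route-BirchSwinnertonDyer-ErratumRoadFive` (rung K2, closes `X11b.MultiplicativeRankOne`; D6 inert re-key rev 16–19), cell `bsd-stepL`,
planner `bsd-stepL-plan` g26 (2026-08-26); v2 = rung re-pointed to shim-p1 g5's certificate row (5015b1, 5, d_K = −23), S1 ∕ S2 ∕ `_of` unchanged. Registered form (as for 19616 ∕ 19627 ∕ 19270): named stubs `stub_*` (sorries ONLY there), stub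
statements by name (`Statement.stub_*` via `type_of%`), the composition `ShimuraKolyvaginOrderBoundInertFromFive_of` concluding the ROUTE DECL
by name (sorry-free, pure logic), and `ShimuraKolyvaginOrderBoundInertFromFive_proof`.

The crux (Kim, Trans. AMS 2024, Thm 4.3 with Rem 4.4 ∕ Cor 4.2, §2.1 (a)–(e): bad p allowed for ν(N⁻) even; proof cited to Kolyvagin 1991 ∕
W. Zhang 2014): for the Shimura curve X_{N⁺,N⁻} with p ∈ S = the (even) set of primes inert in K dividing N exactly, ρ̄_{E,p} onto, p ∤ c(Dt),
a Heegner-type point P with the CST Gross–Zagier display and P non-torsion: #Ш(E/K)[p^∞] ≤ p^(2·ord_p [E(K) : ℤP]). The crux is surjective-image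
ONLY, so the 19616/19627 cut by image regime does not apply. The cut here is by the p-DIVISIBILITY OF THE INDEX — the one distinction Kolyvagin's
method itself reads:

* `stub_inert_unitIndex` — ord_p [E(K):ℤP] = 0: the conclusion is Ш(E/K)[p^∞] = 0. This is Kolyvagin's FIRST theorem (Euler system of Heegner
  points taken mod p only, M = p; Gross's exposition «Kolyvagin's work on modular elliptic curves» §§3–5) transported to X_{N⁺,N⁻}: needs the
  norm ∕ congruence relations of CM points on Shimura curves (Nekovář 2007 §4; Cornut–Vatsal; CST14 §4) and the local conditions at v ∣ N —
  at v = p𝒪_K the cell's reading (R1) (SHIM-T1-MEMO §7.2: v principal, splits completely in K[n], so the derivative classes are locally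
  trivial at v with no Tate-curve computation) and (R2) at the other bad v (Φ_v(k̄)[p^∞]^Frob = 0).
* `stub_inert_divisibleIndex` — 0 < ord_p [E(K):ℤP]: the full ORDER bound #Ш[p^∞] ≤ p^(2·ord_p index) needs Kolyvagin's STRUCTURE theorem
  (Kolyvagin 1991 «On the structure of Selmer groups», McCallum 1991) with M = p^k derivative classes, or Howard's Kolyvagin-system rigidity
  (Howard 2004 Thm 1.6.1-type bound) on the Shimura curve — the step Kim 2024 cites and no refereed source proves at p ∣ N⁻.
* `stub_rung_inert_5015b1` — PLAN-ONLY BC5 rung = the slice at ONE row: W := 5015b1 = [0,0,1,−248,1503] (N = 5015 = 5·17·59 ≥ 5000,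
  non-split at 5 with v₅(Δ) = 2, 17 ∕ 59 split with v = 1, ∏c = 2, ρ̄₅ onto, r = 1; kernel facts in rest-p2's
  `Theorems/ErratumRoadFiveRamNoErratumDataRung5015b1.lean`), p := 5, and the field PINNED by `NumberField.discr K = −23` (so the slice's
  binders force S = {5, 17} inert, 59 split; L(E^{(−23)},1) ≠ 0, so a displayed non-torsion P exists). v2 (shim-p1 g5, replacing g26's
  `stub_rung_inert_5835a1` per the planner's 16:34:35Z (c)): the rung CARRIES its inputs as leading binders — the route's support item
  `PublishedInputsFive` BY NAME and two ATTESTED certificate packages ((i) kit j255090: K₁ = ℚ(√−179), Heegner point y₁ with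
  5 ∤ [E(K₁):ℤy₁] ⇒ Ш(E/ℚ)[5] = 0 classically; (ii) kit j255672: E^{(−23)} has analytic rank 0 with L/Ω = 8, a 5-adic unit ⇒ Skinner C ⇒
  Ш(E^{(−23)})[5^∞] = 0) — so that it is CLOSABLE BY NAME (a rung without fact ∕ certificate binders can be closed by nobody: shim-p2's v5
  pattern for 19616); closing theorem = `Theorems.rung_inert_5015b1_of_items` (tool p457131 ✓ `…InertOfCertificates.lean` +
  `…InertRung5015b1.lean`): Ш(E/ℚ(√−23))[5^∞] = 0 by odd-p base-change splitting. The row sits OFF the kernel's use-locus (5 ∤ ∏c(E)) —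
  on the use-locus no classical certificate exists (GZ V.(2.2)), the raison d'être of the slice. Not used by `_of`.

[cite: Kim2024TAMS, Thm. 4.3, Rem. 4.4, Cor. 4.2, §2.1] [cite: Kolyvagin1991Structure] [cite: McCallum1991] [cite: Gross1991Kolyvagin, §§3–5]
[cite: Nekovar2007, §4] [cite: CaiShuTian2014, Thm. 1.5 special case 1] [cite: Howard2004Duke, Lemma 3.1.5, Thm. 1.6.1] [cite: Zhang2014CJM, Thm. 1.1]
[cite: Cremona1997, Table 1 (curve 5015b1)] [cite: Skinner2016PacificMC, Thm. C] [cite: McCallum1991, §1]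
-/

noncomputable section

open scoped Classical

namespace Summit.BirchSwinnertonDyer.BirchSwinnertonDyer.Cruxes.ShimuraKolyvaginOrderBoundInertFromFive.Birth

/-! The crux decl is the ROUTE decl `Summit.BirchSwinnertonDyer.BirchSwinnertonDyer.Theses.ErratumRoadFive.ShimuraKolyvaginOrderBoundInertFromFive` (item stmt-BirchSwinnertonDyer-19718, ErratumRoadFive rev 16). -/

/-! ## Registered stubs -/

/-- **S1 · `stub_inert_unitIndex` — KOLYVAGIN'S FIRST THEOREM ON X_{N⁺,N⁻} AT p ∣ N⁻ (unit index).** The crux's binders verbatim, plus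
`padicValNat p [E(K):ℤP] = 0`; conclusion then reads Ш(E/K)[p^∞] = 0 (#… ≤ p^0). Mod-p Euler system only.
[cite: Gross1991Kolyvagin, §§3–5] [cite: Nekovar2007, §4] [cite: Kim2024TAMS, Thm. 4.3] -/
theorem stub_inert_unitIndex :
    ∀ (W : WeierstrassCurve ℚ) [W.IsElliptic] [W.IsGloballyMinimal] (p : ℕ) [Fact p.Prime] (N : ℕ) [NeZero N] (K : Type) [Field K] [NumberField K] (S : Finset ℕ) (Dt : Literature.NumberTheory.EllipticCurves.ModularForms.ModularParametrizationData W N) (X : Literature.NumberTheory.Automorphic.ShimuraCurveData (∏ q ∈ S, q) (N / ∏ q ∈ S, q)) (W' : WeierstrassCurve ℚ) [W'.IsElliptic] (P₀ : Literature.NumberTheory.Automorphic.ShimuraParametrizationData X W'), W.conductorNorm ℤ = N → 5 ≤ p → W.HasSurjectiveModNGaloisRep p → Literature.NumberTheory.EllipticCurves.IsImaginaryQuadratic K → Even S.card → (∀ ℓ ∈ S, ℓ.Prime ∧ ℓ ∣ N ∧ ¬ ℓ ^ 2 ∣ N ∧ ((Ideal.span {(ℓ : ℤ)}).primesOver (NumberField.RingOfIntegers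 K)).ncard = 1 ∧ ¬ (ℓ : ℤ) ∣ NumberField.discr K) → (∀ ℓ : ℕ, ℓ.Prime → ℓ ∣ N → ℓ ∉ S → ((Ideal.span {(ℓ : ℤ)}).primesOver (NumberField.RingOfIntegers K)).ncard = 2) → p ∈ S → ¬ (p : ℤ) ∣ Dt.c → P₀.IsMinimalFor W → ∀ (P : (W.baseChange K).toAffine.Point) (degS : ℕ), 0 < degS → padicValNat p degS = padicValNat p P₀.deg → Literature.NumberTheory.EllipticCurves.LDerivEK W K = 8 * (Real.pi : ℂ) ^ 2 * Literature.NumberTheory.EllipticCurves.ModularForms.peterssonProduct (CongruenceSubgroup.Gamma0 N) 2 Dt.f Dt.f / ((((NumberField.Units.torsionOrder K : ℝ) / 2) ^ 2 * √|(NumberField.discr K : ℝ)| : ℝ) : ℂ) * ((P.canonicalHeight : ℂ) / (degS : ℂ)) → ¬ IsOfFinAddOrder P → padicValNat p (AddSubgroup.zmultiples P).index = 0 → Nat.card (AddCommGroup.primaryComponent (W.baseChange K).sha p) ≤ p ^ (2 * padicValNat p (AddSubgroup.zmultiples P).index) := by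
  sorry

/-- **S2 · `stub_inert_divisibleIndex` — KOLYVAGIN'S ORDER BOUND ON X_{N⁺,N⁻} AT p ∣ N⁻ (p-divisible index).** The crux's binders verbatim,
plus `0 < padicValNat p [E(K):ℤP]`: the structure-theorem ∕ Kolyvagin-system step (M = p^k derivatives) that print only cites at p ∣ N⁻.
[cite: Kolyvagin1991Structure] [cite: McCallum1991] [cite: Howard2004Duke] [cite: Kim2024TAMS, Thm. 4.3, Rem. 4.4] -/
theorem stub_inert_divisibleIndex :
    ∀ (W : WeierstrassCurve ℚ) [W.IsElliptic] [W.IsGloballyMinimal] (p : ℕ) [Fact p.Prime] (N : ℕ) [NeZero N] (K : Type) [Field K] [NumberField K] (S : Finset ℕ) (Dt : Literature.NumberTheory.EllipticCurves.ModularForms.ModularParametrizationData W N) (X : Literature.NumberTheory.Automorphic.ShimuraCurveData (∏ q ∈ S, q) (N / ∏ q ∈ S, q)) (W' : WeierstrassCurve ℚ) [W'.IsElliptic] (P₀ : Literature.NumberTheory.Automorphic.ShimuraParametrizationData X W'), W.conductorNorm ℤ = N → 5 ≤ p → W.HasSurjectiveModNGaloisRep p → Literature.NumberTheory.EllipticCurves.IsImaginaryQuadratic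 K → Even S.card → (∀ ℓ ∈ S, ℓ.Prime ∧ ℓ ∣ N ∧ ¬ ℓ ^ 2 ∣ N ∧ ((Ideal.span {(ℓ : ℤ)}).primesOver (NumberField.RingOfIntegers K)).ncard = 1 ∧ ¬ (ℓ : ℤ) ∣ NumberField.discr K) → (∀ ℓ : ℕ, ℓ.Prime → ℓ ∣ N → ℓ ∉ S → ((Ideal.span {(ℓ : ℤ)}).primesOver (NumberField.RingOfIntegers K)).ncard = 2) → p ∈ S → ¬ (p : ℤ) ∣ Dt.c → P₀.IsMinimalFor W → ∀ (P : (W.baseChange K).toAffine.Point) (degS : ℕ), 0 < degS → padicValNat p degS = padicValNat p P₀.deg → Literature.NumberTheory.EllipticCurves.LDerivEK W K = 8 * (Real.pi : ℂ) ^ 2 * Literature.NumberTheory.EllipticCurves.ModularForms.peterssonProduct (CongruenceSubgroup.Gamma0 N) 2 Dt.f Dt.f / ((((NumberField.Units.torsionOrder K : ℝ) / 2) ^ 2 * √|(NumberField.discr K : ℝ)| : ℝ) : ℂ) * ((P.canonicalHeight : ℂ) / (degS : ℂ)) → ¬ IsOfFinAddOrder P → 0 < padicValNat p (AddSubgroup.zmultiples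 P).index → Nat.card (AddCommGroup.primaryComponent (W.baseChange K).sha p) ≤ p ^ (2 * padicValNat p (AddSubgroup.zmultiples P).index) := by
  sorry

/-- **R1 · `stub_rung_inert_5015b1` — PLAN-ONLY BC5 RUNG (the slice at the row (5015b1, 5, d_K = −23), v2).** Leading binders:
`PublishedInputsFive` (by name) and the two attested certificate packages (kit j255090 ∕ j255672); then the crux's binders at
`W := 5015b1`, `p := 5` with `NumberField.discr K = −23` inserted after `IsImaginaryQuadratic K`. Closed by name by
`Summit.BirchSwinnertonDyer.BirchSwinnertonDyer.Theorems.rung_inert_5015b1_of_items` (shim-p1 g5). [cite: Cremona1997, Table 1 (5015b1)]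
[cite: Kim2024TAMS, Thm. 4.3] [cite: Skinner2016PacificMC, Thm. C] [cite: McCallum1991, §1] -/
theorem stub_rung_inert_5015b1
    [((⟨0, 0, 1, -248, 1503⟩ : WeierstrassCurve ℤ).baseChange ℚ).IsElliptic] [((⟨0, 0, 1, -248, 1503⟩ : WeierstrassCurve ℤ).baseChange ℚ).IsGloballyMinimal] [Fact (Nat.Prime 5)] :
    Summit.BirchSwinnertonDyer.BirchSwinnertonDyer.Theses.ErratumRoadFive.PublishedInputsFive →
    ∀ (K₁ : Type) [Field K₁] [NumberField K₁], Literature.NumberTheory.EllipticCurves.IsImaginaryQuadratic K₁ → NumberField.discr K₁ = -179 → Literature.NumberTheory.EllipticCurves.SatisfiesHeegnerHypothesis 5015 K₁ → ∀ (y₁ : (((⟨0, 0, 1, -248, 1503⟩ : WeierstrassCurve ℤ).baseChange ℚ).baseChange K₁).toAffine.Point), Literature.NumberTheory.EllipticCurves.IsHeegnerPoint 5015 ((⟨0, 0, 1, -248, 1503⟩ : WeierstrassCurve ℤ).baseChange ℚ) K₁ y₁ → ¬ IsOfFinAddOrder y₁ → ¬ 5 ∣ (AddSubgroup.zmultiples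 y₁).index →
    (((⟨0, 0, 1, -248, 1503⟩ : WeierstrassCurve ℤ).baseChange ℚ).quadraticTwist ((-23 : ℤ) : ℚ)).entireLFunction 1 ≠ 0 →
    (∀ (Wd : WeierstrassCurve ℚ) [Wd.IsElliptic] [Wd.IsGloballyMinimal] (Cd : WeierstrassCurve.VariableChange ℚ), Cd • ((⟨0, 0, 1, -248, 1503⟩ : WeierstrassCurve ℤ).baseChange ℚ).quadraticTwist ((-23 : ℤ) : ℚ) = Wd → ∀ q : ℚ, Wd.entireLFunction 1 / (Wd.realPeriodRat : ℂ) = (q : ℂ) → padicValRat 5 q ≤ 0) →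
    ∀ (N : ℕ) [NeZero N] (K : Type) [Field K] [NumberField K] (S : Finset ℕ) (Dt : Literature.NumberTheory.EllipticCurves.ModularForms.ModularParametrizationData ((⟨0, 0, 1, -248, 1503⟩ : WeierstrassCurve ℤ).baseChange ℚ) N) (X : Literature.NumberTheory.Automorphic.ShimuraCurveData (∏ q ∈ S, q) (N / ∏ q ∈ S, q)) (W' : WeierstrassCurve ℚ) [W'.IsElliptic] (P₀ : Literature.NumberTheory.Automorphic.ShimuraParametrizationData X W'), ((⟨0, 0, 1, -248, 1503⟩ : WeierstrassCurve ℤ).baseChange ℚ).conductorNorm ℤ = N → 5 ≤ 5 → ((⟨0, 0, 1, -248, 1503⟩ : WeierstrassCurve ℤ).baseChange ℚ).HasSurjectiveModNGaloisRep 5 → Literature.NumberTheory.EllipticCurves.IsImaginaryQuadratic K → NumberField.discr K = -23 → Even S.card → (∀ ℓ ∈ S, ℓ.Prime ∧ ℓ ∣ N ∧ ¬ ℓ ^ 2 ∣ N ∧ ((Ideal.span {(ℓ : ℤ)}).primesOver (NumberField.RingOfIntegers K)).ncard = 1 ∧ ¬ (ℓ : ℤ) ∣ NumberField.discr K) → (∀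 ℓ : ℕ, ℓ.Prime → ℓ ∣ N → ℓ ∉ S → ((Ideal.span {(ℓ : ℤ)}).primesOver (NumberField.RingOfIntegers K)).ncard = 2) → 5 ∈ S → ¬ (5 : ℤ) ∣ Dt.c → P₀.IsMinimalFor ((⟨0, 0, 1, -248, 1503⟩ : WeierstrassCurve ℤ).baseChange ℚ) → ∀ (P : (((⟨0, 0, 1, -248, 1503⟩ : WeierstrassCurve ℤ).baseChange ℚ).baseChange K).toAffine.Point) (degS : ℕ), 0 < degS → padicValNat 5 degS = padicValNat 5 P₀.deg → Literature.NumberTheory.EllipticCurves.LDerivEK ((⟨0, 0, 1, -248, 1503⟩ : WeierstrassCurve ℤ).baseChange ℚ) K = 8 * (Real.pi : ℂ) ^ 2 * Literature.NumberTheory.EllipticCurves.ModularForms.peterssonProduct (CongruenceSubgroup.Gamma0 N) 2 Dt.f Dt.f / ((((NumberField.Units.torsionOrder K : ℝ) / 2) ^ 2 * √|(NumberField.discr K : ℝ)| : ℝ) : ℂ) * ((P.canonicalHeight : ℂ) / (degS : ℂ)) → ¬ IsOfFinAddOrder P → Nat.card (AddCommGroup.primaryComponent (((⟨0, 0, 1,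 -248, 1503⟩ : WeierstrassCurve ℤ).baseChange ℚ).baseChange K).sha 5) ≤ 5 ^ (2 * padicValNat 5 (AddSubgroup.zmultiples P).index) := by
  sorry

/-! ## Stub statements by name -/

namespace Statement

/-- Statement of `stub_inert_unitIndex`. -/
abbrev stub_inert_unitIndex : Prop := type_of% @Birth.stub_inert_unitIndex
/-- Statement of `stub_inert_divisibleIndex`. -/
abbrev stub_inert_divisibleIndex : Prop := type_of% @Birth.stub_inert_divisibleIndex
/-- Statement of `stub_rung_inert_5015b1` (plan-only BC5 rung v2; not used by `ShimuraKolyvaginOrderBoundInertFromFive_of`). -/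
abbrev stub_rung_inert_5015b1 : Prop := type_of% @Birth.stub_rung_inert_5015b1

end Statement

/-! ## The composition (sorry-free): the two index-regime stub STATEMENTS imply the crux, BY NAME -/

/-- **`ShimuraKolyvaginOrderBoundInertFromFive_of`** — the inert slice from its unit-index and divisible-index pieces: case split on
`padicValNat p (AddSubgroup.zmultiples P).index = 0`. Pure logic. -/
theorem ShimuraKolyvaginOrderBoundInertFromFive_of (hU : Statement.stub_inert_unitIndex)
    (hD : Statement.stub_inert_divisibleIndex) :
    Summit.BirchSwinnertonDyer.BirchSwinnertonDyer.Theses.ErratumRoadFive.ShimuraKolyvaginOrderBoundInertFromFive := by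
  intro W _ _ p _ N _ K _ _ S Dt X W' _ P₀ hN hp5 hsurj hK hS hin hsp hpS hc hmin P degS h0 hv hL hnt
  by_cases h0i : padicValNat p (AddSubgroup.zmultiples P).index = 0
  · exact hU W p N K S Dt X W' P₀ hN hp5 hsurj hK hS hin hsp hpS hc hmin P degS h0 hv hL hnt h0i
  · exact hD W p N K S Dt X W' P₀ hN hp5 hsurj hK hS hin hsp hpS hc hmin P degS h0 hv hL hnt (Nat.pos_of_ne_zero h0i)

/-- The crux along this line, MODULO exactly the two registered index-regime stubs (sorries live only in `stub_*`). -/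
theorem ShimuraKolyvaginOrderBoundInertFromFive_proof :
    Summit.BirchSwinnertonDyer.BirchSwinnertonDyer.Theses.ErratumRoadFive.ShimuraKolyvaginOrderBoundInertFromFive :=
  ShimuraKolyvaginOrderBoundInertFromFive_of stub_inert_unitIndex stub_inert_divisibleIndex

end Summit.BirchSwinnertonDyer.BirchSwinnertonDyer.Cruxes.ShimuraKolyvaginOrderBoundInertFromFive.Birth

end
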